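import Literature.AlgebraicGeometry.Resolution.RegularQuotientIdeal
import Mathlib.RingTheory.RegularLocalRing.Defs
import Mathlib.RingTheory.Localization.LocalizationLocalization
import Mathlib.RingTheory.Localization.Submodule
import Mathlib.RingTheory.Ideal.Colon
import HarnessLib

/-!
# A regular centre in a regular ring is locally cut out by a quasi-regular sequence

Topic: `Literature/AlgebraicGeometry/Resolution`. PROVED (local algebra for the reduction of
Liu, Thm. 8.1.19 (a), to the affine quasi-regular case of `AffineBlowupRegular.lean`): let `A`
be a regular ring (`IsRegularRing`), `I` an ideal with `A/I` regular, `p ⊇ I` a prime. Then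
there are `g ∉ p` and `f_1, …, f_c ∈ I` such that in every localisation `A[1/g]`:
`I A[1/g] = (f_1, …, f_c)`, the `f_i` form a quasi-regular sequence, and `A[1/g]` and
`A[1/g]/(f)` are regular rings (`exists_isQuasiRegular_away_of_isRegularRing`). In the regular
local ring `A_p` the ideal `I A_p` has regular quotient, so it is generated by elements of `I`
with linearly independent differentials, an `A_p`-sequence (`RegularQuotientIdeal.lean`); the
generation and the regular-sequence property spread from `A_p` to a neighbourhood `D(g)`
because `A` is Noetherian, and regular sequences are quasi-regular (Rees, Matsumura 16.2).

* `exists_uniform_multiplier_of_regular_at_prime` — if each `f_i` is a non-zero-divisor modulo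
  `(f_j : j < i)` after localising at `p` (colon form), one `g ∉ p` works uniformly (the colon
  ideals are finitely generated);
* `regularSeq_map_of_uniform_multiplier` — then the images in `A[1/g]` form an
  `A[1/g]`-sequence;
* `isRegularRing_of_isLocalization` — localisations of regular rings are regular;
* `isRegularLocalRing_localization_quotient_of_le` — `A_p / I A_p` is a localisation of `A/I`,
  regular local if `A/I` is a regular ring;
* `IsQuasiRegular.map_ringEquiv` — quasi-regularity transports along ring isomorphisms;
* `exists_isQuasiRegular_away_of_isRegularRing` — **the local structure theorem**.

## Sources

* Q. Liu, *Algebraic Geometry and Arithmetic Curves*, OUP 2002, Thm. 8.1.19 (a) and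
  Exercise 8.1.4 (PDF pp. 383, 391); §6.3.2 (regular immersions). [Liu2002]
* H. Matsumura, *Commutative Ring Theory*, CUP 1986, Thms. 14.2, 16.2. [Matsumura1987]
-/
noncomputable section

open IsLocalRing

namespace Literature.AlgebraicGeometry.Resolution

universe u

/-! ## Spreading a regular sequence from a prime to a neighbourhood -/

section Spread

variable {A : Type u} [CommRing A] {c : ℕ} (f : Fin c → A)

/-- **Uniform denominators**: if for each `i` every `y` with `f_i y ∈ (f_j : j < i)` is moved
into `(f_j : j < i)` by some element outside the prime `p` (i.e. `f_i` is a non-zero-divisor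
modulo `(f_j : j < i)` after localising at `p`), then — `A` being Noetherian — a single `g ∉ p`
does it for all `i` and `y`. [folklore] -/
theorem exists_uniform_multiplier_of_regular_at_prime [IsNoetherianRing A] (p : Ideal A)
    [hp : p.IsPrime]
    (hreg : ∀ (i : Fin c) (y : A), f i * y ∈ Ideal.span (f '' Set.Iio i) →
      ∃ s : A, s ∉ p ∧ s * y ∈ Ideal.span (f '' Set.Iio i)) :
    ∃ g : A, g ∉ p ∧ ∀ (i : Fin c) (y : A), f i * y ∈ Ideal.span (f '' Set.Iio i) →
      g * y ∈ Ideal.span (f '' Set.Iio i) := by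
  classical
  -- for each `i`, a multiplier `g_i` working for the (finitely generated) colon ideal
  have hi : ∀ i : Fin c, ∃ g : A, g ∉ p ∧ ∀ y : A, f i * y ∈ Ideal.span (f '' Set.Iio i) →
      g * y ∈ Ideal.span (f '' Set.Iio i) := by
    intro i
    set J : Ideal A := Ideal.span (f '' Set.Iio i) with hJ
    set K : Ideal A := Submodule.colon J {f i} with hK
    have hKmem : ∀ y : A, y ∈ K ↔ f i * y ∈ J := fun y => by
      rw [hK, Submodule.mem_colon_singleton, smul_eq_mul, mul_comm]
    obtain ⟨gens, hgens⟩ := (IsNoetherian.noetherian K : K.FG)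
    have hsel : ∀ y : A, y ∈ gens → ∃ s : A, s ∉ p ∧ s * y ∈ J := fun y hy =>
      hreg i y ((hKmem y).mp (hgens ▸ Submodule.subset_span hy))
    choose! s hs using hsel
    refine ⟨∏ y ∈ gens, s y, ?_, ?_⟩
    · intro hmem
      obtain ⟨y, hy, hsy⟩ := (hp.prod_mem_iff).mp hmem
      exact (hs y hy).1 hsy
    · intro y hy
      have hyK : y ∈ K := (hKmem y).mpr hy
      -- the set of `y` with `g y ∈ J` is an ideal containing the generators of `K`
      let Mg : Ideal A := Submodule.comap (LinearMap.mulLeft A (∏ y ∈ gens, s y)) J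
      have hgensM : (gens : Set A) ⊆ Mg := by
        intro z hz
        change (∏ y ∈ gens, s y) * z ∈ J
        rw [← Finset.prod_erase_mul _ _ hz, mul_assoc]
        exact J.mul_mem_left _ (hs z hz).2
      have hKM : K ≤ Mg := by
        rw [← hgens]
        exact Submodule.span_le.mpr hgensM
      exact hKM hyK
  choose g hg using hi
  refine ⟨∏ i, g i, ?_, ?_⟩
  · intro hmem
    obtain ⟨i, -, hi⟩ := (hp.prod_mem_iff).mp hmem
    exact (hg i).1 hi
  · intro i y hy
    rw [← Finset.prod_erase_mul _ _ (Finset.mem_univ i), mul_assoc]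
    exact Ideal.mul_mem_left _ _ ((hg i).2 y hy)

/-- **Spreading**: if `g` is a uniform multiplier as above, then in any localisation `A[1/g]` the
images of `f_1, …, f_c` form an `A[1/g]`-sequence (colon form). [folklore] -/
theorem regularSeq_map_of_uniform_multiplier {g : A}
    (hg : ∀ (i : Fin c) (y : A), f i * y ∈ Ideal.span (f '' Set.Iio i) →
      g * y ∈ Ideal.span (f '' Set.Iio i))
    (L : Type u) [CommRing L] [Algebra A L] [IsLocalization.Away g L] (i : Fin c) (z : L)
    (hz : algebraMap A L (f i) * z ∈ Ideal.span ((algebraMap A L ∘ f) '' Set.Iio i)) :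
    z ∈ Ideal.span ((algebraMap A L ∘ f) '' Set.Iio i) := by
  have hJ : Ideal.span ((algebraMap A L ∘ f) '' Set.Iio i) =
      (Ideal.span (f '' Set.Iio i)).map (algebraMap A L) := by
    rw [Ideal.map_span, Set.image_comp]
  rw [hJ] at hz ⊢
  obtain ⟨⟨y, ⟨_, n, rfl⟩⟩, rfl⟩ := IsLocalization.mk'_surjective (Submonoid.powers g) z
  -- `f_i y / gⁿ ∈ J A[1/g]` gives `gᵏ f_i y ∈ J`, hence `g^(k+1) y ∈ J`
  have h1 : IsLocalization.mk' L (f i * y) (⟨g ^ n, n, rfl⟩ : Submonoid.powers g) ∈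
      (Ideal.span (f '' Set.Iio i)).map (algebraMap A L) := by
    rw [IsLocalization.mk'_eq_mul_mk'_one, map_mul, mul_assoc, ← IsLocalization.mk'_eq_mul_mk'_one]
    exact hz
  rw [IsLocalization.mk'_mem_map_algebraMap_iff (Submonoid.powers g)] at h1
  obtain ⟨_, ⟨k, rfl⟩, hk⟩ := h1
  have h2 : g ^ (k + 1) * y ∈ Ideal.span (f '' Set.Iio i) := by
    rw [pow_succ', mul_assoc]
    refine hg i _ ?_
    have : f i * (g ^ k * y) = g ^ k * (f i * y) := by ring
    rw [this]
    exact hk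
  rw [IsLocalization.mk'_mem_map_algebraMap_iff (Submonoid.powers g)]
  exact ⟨g ^ (k + 1), ⟨k + 1, rfl⟩, h2⟩

end Spread

/-! ## Localisations of regular rings; localised quotients -/

section Localization

variable {A : Type u} [CommRing A]

/-- **A localisation of a regular ring is a regular ring**: its local rings are local rings of
`A`. [folklore] -/
theorem isRegularRing_of_isLocalization [IsRegularRing A] (M : Submonoid A) (S : Type u)
    [CommRing S] [Algebra A S] [IsLocalization M S] : IsRegularRing S := by
  haveI : IsNoetherianRing S := IsLocalization.isNoetherianRing M S inferInstance
  rw [isRegularRing_iff]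
  intro Q hQ
  set q : Ideal A := Q.comap (algebraMap A S) with hq
  haveI : IsLocalization.AtPrime (Localization.AtPrime Q) q :=
    IsLocalization.isLocalization_isLocalization_atPrime_isLocalization M (Localization.AtPrime Q) Q
  exact IsRegularLocalRing.of_ringEquiv
    (IsLocalization.algEquiv q.primeCompl (Localization.AtPrime q) (Localization.AtPrime Q)).toRingEquiv

/-- **Localising a regular quotient**: if `A/I` is a regular ring and `p ⊇ I` is a prime, then
`A_p / I A_p` — the localisation of `A/I` at `p/I` — is a regular local ring. [folklore] -/
theorem isRegularLocalRing_localization_quotient_of_le (I : Ideal A) [hreg : IsRegularRing (A ⧸ I)]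
    (p : Ideal A) [p.IsPrime] (hIp : I ≤ p) :
    IsRegularLocalRing (Localization.AtPrime p ⧸ I.map (algebraMap A (Localization.AtPrime p))) := by
  set pbar : Ideal (A ⧸ I) := p.map (Ideal.Quotient.mk I) with hpbar
  have hcomap : pbar.comap (Ideal.Quotient.mk I) = p := by
    rw [hpbar, Ideal.comap_map_of_surjective _ Ideal.Quotient.mk_surjective,
      ← RingHom.ker_eq_comap_bot, Ideal.mk_ker, sup_eq_left]
    exact hIp
  haveI hpbarp : pbar.IsPrime :=
    Ideal.map_isPrime_of_surjective Ideal.Quotient.mk_surjective (by rwa [Ideal.mk_ker])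
  have hmem : ∀ c : A, Ideal.Quotient.mk I c ∈ pbar ↔ c ∈ p := fun c => by
    rw [← Ideal.mem_comap, hcomap]
  have hM : Algebra.algebraMapSubmonoid (A ⧸ I) p.primeCompl = pbar.primeCompl := by
    ext b
    constructor
    · rintro ⟨c, hc, rfl⟩
      exact fun h => hc ((hmem c).mp h)
    · intro hb
      obtain ⟨c, rfl⟩ := Ideal.Quotient.mk_surjective b
      exact ⟨c, fun h => hb ((hmem c).mpr h), rfl⟩
  haveI : IsLocalization.AtPrime
      (Localization.AtPrime p ⧸ I.map (algebraMap A (Localization.AtPrime p))) pbar := by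
    have := (inferInstance : IsLocalization (Algebra.algebraMapSubmonoid (A ⧸ I) p.primeCompl)
      (Localization.AtPrime p ⧸ I.map (algebraMap A (Localization.AtPrime p))))
    rwa [hM] at this
  exact IsRegularLocalRing.of_ringEquiv (IsLocalization.algEquiv pbar.primeCompl
    (Localization.AtPrime pbar)
    (Localization.AtPrime p ⧸ I.map (algebraMap A (Localization.AtPrime p)))).toRingEquiv

/-- Quasi-regularity is invariant under ring isomorphisms. [folklore] -/
theorem IsQuasiRegular.map_ringEquiv {B : Type u} [CommRing B] {c : ℕ} {f : Fin c → A}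
    (hf : IsQuasiRegular f) (e : A ≃+* B) : IsQuasiRegular (e ∘ f) := by
  classical
  intro n F hF hFx
  -- pull `F` back along `e`
  set F' : MvPolynomial (Fin c) A := MvPolynomial.map (e.symm : B →+* A) F with hF'
  have hF'hom : F'.IsHomogeneous n := hF.map _
  have heval : MvPolynomial.eval f F' = e.symm (MvPolynomial.eval (e ∘ f) F) := by
    rw [hF', MvPolynomial.eval_map, ← MvPolynomial.coe_eval₂Hom]
    have : (e.symm : B →+* A).comp (MvPolynomial.eval₂Hom (RingHom.id B) (e ∘ f)) =
        MvPolynomial.eval₂Hom (e.symm : B →+* A) f := by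
      refine MvPolynomial.ringHom_ext (fun b => ?_) (fun i => ?_)
      · simp
      · simp
    rw [← this]
    rfl
  have hspan : (Ideal.span (Set.range (e ∘ f))).map (e.symm : B →+* A) = Ideal.span (Set.range f) := by
    rw [Ideal.map_span, ← Set.range_comp]
    congr 1
    ext a
    simp only [Set.mem_range, Function.comp_apply, RingHom.coe_coe, RingEquiv.symm_apply_apply]
  have hF'x : MvPolynomial.eval f F' ∈ Ideal.span (Set.range f) ^ (n + 1) := by
    rw [heval, ← hspan, ← Ideal.map_pow]
    exact Ideal.mem_map_of_mem _ hFx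
  have key := hf n F' hF'hom hF'x
  -- push forward again
  have hFF' : F = MvPolynomial.map (e : A →+* B) F' := by
    rw [hF', MvPolynomial.map_map]
    have : (e : A →+* B).comp (e.symm : B →+* A) = RingHom.id B := by
      ext b; simp
    rw [this, MvPolynomial.map_id]
  rw [hFF', (MvPolynomial.mem_map_C_iff)]
  intro m
  rw [MvPolynomial.coeff_map]
  have hc := (MvPolynomial.mem_map_C_iff.mp key) m
  have : Ideal.span (Set.range (e ∘ f)) = (Ideal.span (Set.range f)).map (e : A →+* B) := by
    rw [Ideal.map_span, ← Set.range_comp]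
    rfl
  rw [this]
  exact Ideal.mem_map_of_mem _ hc

end Localization

/-! ## Regular centres are locally cut out by quasi-regular sequences -/

/-- **Local structure of a regular centre in a regular ring**: let `A` be a regular ring, `I` an
ideal with `A/I` a regular ring, and `p ⊇ I` a prime. Then there are `g ∉ p` and
`f_1, …, f_c ∈ I` such that in `A[1/g]` (any localisation away from `g`): `I A[1/g] = (f)`,
`f` is quasi-regular, and `A[1/g]`, `A[1/g]/(f)` are regular rings — i.e. over the
neighbourhood `D(g)` of `p` the centre `V(I)` is cut out by a quasi-regular sequence with regular
quotient, the hypotheses of `affineBlowup.isRegular_of_isQuasiRegular`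
(`AffineBlowupRegular.lean`). Proof: in the regular local ring `A_p` the ideal `I A_p` (with
regular quotient) is generated by elements `f_i ∈ I` with independent differentials, an
`A_p`-sequence (`RegularQuotientIdeal.lean`); spread the generation of `I` and the regularity of
the sequence from `A_p` to some `A[1/g]` (`exists_uniform_multiplier_of_regular_at_prime`,
`regularSeq_map_of_uniform_multiplier`), where regular sequences are quasi-regular (Rees).
[cite: Liu2002, Thm. 8.1.19 (a) (reduction to the affine case)] -/
theorem exists_isQuasiRegular_away_of_isRegularRing {A : Type u} [CommRing A] [IsRegularRing A]
    (I : Ideal A) [IsRegularRing (A ⧸ I)] (p : Ideal A) [hp : p.IsPrime] (hIp : I ≤ p) :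
    ∃ g : A, g ∉ p ∧ ∃ (c : ℕ) (f : Fin c → A), (∀ i, f i ∈ I) ∧
      ∀ (L : Type u) [CommRing L] [Algebra A L] [IsLocalization.Away g L],
        Ideal.map (algebraMap A L) I = Ideal.span (Set.range (algebraMap A L ∘ f)) ∧
        IsQuasiRegular (algebraMap A L ∘ f) ∧ IsRegularRing L ∧
        IsRegularRing (L ⧸ Ideal.map (algebraMap A L) I) := by
  classical
  -- the regular local ring `A_p` and the ideal `J = I A_p` with regular quotient
  haveI : IsRegularLocalRing (Localization.AtPrime p) := inferInstance
  have hJm : I.map (algebraMap A (Localization.AtPrime p)) ≤ maximalIdeal (Localization.AtPrime p) := by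
    rw [← Localization.AtPrime.map_eq_maximalIdeal]
    exact Ideal.map_mono hIp
  haveI := isRegularLocalRing_localization_quotient_of_le I p hIp
  have hG : Ideal.span (algebraMap A (Localization.AtPrime p) '' (I : Set A)) =
      I.map (algebraMap A (Localization.AtPrime p)) := rfl
  obtain ⟨c, f', hf'G, hspan', -, hcolon'⟩ :=
    exists_isQuasiRegular_span_eq_of_isRegularLocalRing_quotient hJm _ hG
  -- preimages `f_i ∈ I`
  have hpre : ∀ i, ∃ a : A, a ∈ I ∧ algebraMap A (Localization.AtPrime p) a = f' i := fun i => by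
    obtain ⟨a, ha, h⟩ := hf'G i
    exact ⟨a, ha, h⟩
  choose f hfI hff' using hpre
  have hrange : Set.range f' = Set.range (algebraMap A (Localization.AtPrime p) ∘ f) := by
    ext z
    simp only [Set.mem_range, Function.comp_apply, hff']
  have himg : ∀ i : Fin c, Ideal.span (f' '' Set.Iio i) =
      (Ideal.span (f '' Set.Iio i)).map (algebraMap A (Localization.AtPrime p)) := fun i => by
    rw [Ideal.map_span, Set.image_image]
    congr 1
    ext z
    simp only [Set.mem_image, hff']
  -- `f` is an `A_p`-sequence, in colon form over `A`
  have hreg : ∀ (i : Fin c) (y : A), f i * y ∈ Ideal.span (f '' Set.Iio i) →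
      ∃ s : A, s ∉ p ∧ s * y ∈ Ideal.span (f '' Set.Iio i) := by
    intro i y hy
    have h1 : f' i * algebraMap A (Localization.AtPrime p) y ∈ Ideal.span (f' '' Set.Iio i) := by
      rw [himg, ← hff', ← map_mul]
      exact Ideal.mem_map_of_mem _ hy
    have h2 := hcolon' i (Set.Iio i) (fun h => lt_irrefl i h) _ h1
    rw [himg, IsLocalization.algebraMap_mem_map_algebraMap_iff p.primeCompl] at h2
    obtain ⟨s, hs, hsy⟩ := h2
    exact ⟨s, hs, hsy⟩
  obtain ⟨g₁, hg₁p, hg₁⟩ := exists_uniform_multiplier_of_regular_at_prime f p hreg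
  -- the generators of `I` lie in `(f) A_p`: clear denominators
  obtain ⟨gens, hgens⟩ := (IsNoetherian.noetherian I : I.FG)
  have hgen1 : ∀ x : A, x ∈ gens → ∃ t : A, t ∉ p ∧ t * x ∈ Ideal.span (Set.range f) := by
    intro x hx
    have hxI : x ∈ I := hgens ▸ Submodule.subset_span hx
    have h1 : algebraMap A (Localization.AtPrime p) x ∈ Ideal.span (Set.range f') := by
      rw [hspan']
      exact Ideal.mem_map_of_mem _ hxI
    rw [hrange, Set.range_comp, ← Ideal.map_span,
      IsLocalization.algebraMap_mem_map_algebraMap_iff p.primeCompl] at h1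
    obtain ⟨t, ht, htx⟩ := h1
    exact ⟨t, ht, htx⟩
  choose! t ht using hgen1
  have hg₀p : (∏ x ∈ gens, t x) ∉ p := by
    intro hmem
    obtain ⟨x, hx, htx⟩ := (hp.prod_mem_iff).mp hmem
    exact (ht x hx).1 htx
  refine ⟨(∏ x ∈ gens, t x) * g₁, fun h => (hp.mem_or_mem h).elim hg₀p hg₁p, c, f, hfI, ?_⟩
  intro L _ _ _
  have hunit : ∀ x : A, x ∈ gens → IsUnit (algebraMap A L (t x)) := by
    intro x hx
    have hu : IsUnit (algebraMap A L ((∏ x ∈ gens, t x) * g₁)) :=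
      IsLocalization.Away.algebraMap_isUnit _
    obtain ⟨r, hr⟩ : t x ∣ (∏ x ∈ gens, t x) * g₁ := (Finset.dvd_prod_of_mem t hx).mul_right g₁
    rw [hr, map_mul] at hu
    exact isUnit_of_mul_isUnit_left hu
  -- (a) `I A[1/g] = (f)`
  have hIL : I.map (algebraMap A L) = Ideal.span (Set.range (algebraMap A L ∘ f)) := by
    apply le_antisymm
    · rw [← hgens, Ideal.map_span, Ideal.span_le]
      rintro _ ⟨x, hx, rfl⟩
      have hx' : x ∈ gens := hx
      have hmem : algebraMap A L (t x * x) ∈ Ideal.span (Set.range (algebraMap A L ∘ f)) := by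
        rw [Set.range_comp, ← Ideal.map_span]
        exact Ideal.mem_map_of_mem _ (ht x hx').2
      rw [map_mul] at hmem
      exact (Ideal.unit_mul_mem_iff_mem _ (hunit x hx')).mp hmem
    · rw [Ideal.span_le]
      rintro _ ⟨i, rfl⟩
      exact Ideal.mem_map_of_mem _ (hfI i)
  -- (b) quasi-regular in `A[1/g]`
  have hg : ∀ (i : Fin c) (y : A), f i * y ∈ Ideal.span (f '' Set.Iio i) →
      (∏ x ∈ gens, t x) * g₁ * y ∈ Ideal.span (f '' Set.Iio i) := fun i y hy => by
    rw [mul_assoc]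
    exact Ideal.mul_mem_left _ _ (hg₁ i y hy)
  have hqr : IsQuasiRegular (algebraMap A L ∘ f) :=
    isQuasiRegular_of_regularSeq c _ fun i z hz => regularSeq_map_of_uniform_multiplier f hg L i z hz
  -- (c), (d) regularity of `A[1/g]` and of `A[1/g] / I A[1/g]`, localisations of `A` and `A/I`
  haveI hL : IsRegularRing L := isRegularRing_of_isLocalization (Submonoid.powers ((∏ x ∈ gens, t x) * g₁)) L
  have hLq : IsRegularRing (L ⧸ I.map (algebraMap A L)) :=
    isRegularRing_of_isLocalization
      (Algebra.algebraMapSubmonoid (A ⧸ I) (Submonoid.powers ((∏ x ∈ gens, t x) * g₁)))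
      (L ⧸ I.map (algebraMap A L))
  exact ⟨hIL, hqr, hL, hLq⟩

end Literature.AlgebraicGeometry.Resolution

end
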